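import Summits.QuantumFields.BalabanUV.T4Continuum.Support.NE7QbarIterPointwiseB8Prep
import Literature.MathematicalPhysics.QuantumFieldTheory.Balaban1983to89.B7Ineq146General
import HarnessLib

/-!
# NE7QbarIterPointwiseB8 — THE POINTWISE REMAINDER TOWER ON B8's SURFACE: `‖QbarIter L (j+1) W Z (z,κ)‖ ≤ K·(Lʲ)²(Lʲ)^{−d}·‖Z‖²_{ℓ²(periodBox (N·L^{j+1}))}`
# under (1.37), k-FREE, NO sup factor, NO regularity of `Z` — at `d = 4`: `sup‖φ̃‖ ≤ K·L²·M⁻²·dirSq Z ≤ K·L²·‖Z‖_w²` (`M = L^{j+1}`)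

Cell `pub-balaban`, rung (B)+1 sub-cell t4; written by the row-NE7b owner lineage `b2b-balaban-t4-ne7b-p1` (gen 155) as JUNCTION SERVICE for row NE7's open socket piece
(S-g′) of ROAD-G107 §4 (journal [NE7bP1-G155-FINDING-1], exit (a)): the normal part `X_N = R₀φ̃` of `NE7PairDecompNL0.decomp_of_nl0_pair` is controlled in sup (hence,
trivially, in covariant gradient) by `supC0∕(M(1−θ_c))·sup‖φ̃‖` (`NE7FrameFreeRightInverse.norm_rightInvW0_le`), and `φ̃ = QbarIter 2 (k+1) Us X` at the (R1″) representative
(`NE7SliceRepresentativeDbar.coarseDatumNL_eq_QbarIter_of_mlog_vcov_eq`).  The tree's ℓ² tower `Spine/NE3/RemainderTowerB8.sqrt_l2sq_QbarIter_le` bounds `‖φ̃‖_{ℓ²}` by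
`sup‖Z‖·‖Z‖_{ℓ²}` (ONE sup factor); THIS FILE bounds `φ̃` POINTWISE by `‖Z‖²_{ℓ²}·(Lʲ)^{2−d}` (NO sup factor) — at `d = 4` one power of `M⁻¹ = θ^{18k}` better in the END currency,
which closes (Gᶜ_w) for `X_N` by the trivial bound (FINDING-1 (F3)∕(F5)(a)).
THE ARGUMENT.  Same tower as `RemainderTowerB8` (telescope `RemainderTelescopeB8.linCovIter_sub_logCovIter_eq_sum`, `A_k = 0` by (1.37), the strong ℓ² induction
`RemainderTowerArith.tower_l2_induction` giving `‖A_i‖_{ℓ²} ≤ 4ρ^i‖B‖_{ℓ²}`), but the last step is POINTWISE: each propagated one-step remainder `Lin_{k−i−1}(Ū₀^{i+1})C_i` is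
bounded AT THE BOND by [B7] (146) for a general field (`B7Ineq146General.ineq146_general_uniform`, this lineage's p797661: `(1+θ)·L^m(L^m)^{−d}` × the ℓ¹-mass of `C_i` over the
two-`m`-block), the two-block mass by twice the ℓ¹-mass over one period (§1, two translated period boxes cover the two-block), and the period ℓ¹-mass of `C_i` by the field's
ℓ²-mass WITHOUT a sup factor (`RemainderSumsStepB8.sum_norm_Ccov_le`: `Σ‖C_i‖ ≤ C₁L²d(4L+1)^d·‖A_i‖²_{ℓ²}`); the exponents collect to `Σ_{i<k} L^{k−1+i}·((L^{k−1})^d)⁻¹ ≤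
2(L^{k−1})²((L^{k−1})^d)⁻¹`.
WHAT ([folklore]; 0 def, 0 sorry; lattice counting and the (1.37)-free tower facts are file 1∕2 `NE7QbarIterPointwiseB8Prep`).  **`norm_QbarIter_le_pointwise`** — hypotheses = those of `RemainderTowerB8.sqrt_l2sq_QbarIter_le` VERBATIM plus ONE more k-free smallness line `h145'`
(`8d·thetaGen d L (2α₀)·L⁻⁴ ≤ 1`, [B7] (145) at the doubled plaquette constant of the level backgrounds); conclusion: for every `z κ`,
`‖QbarIter L (j+1) W Z z κ‖ ≤ 64(1 + thetaGen d L (2α₀))·C₁L²d(4L+1)^d·(Lʲ)²((Lʲ)^d)⁻¹·l2sq (periodBox (N·L^{j+1})) Z`.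
HONEST FRAMING (page 1): lattice kinematics ∕ bookkeeping over landed kernel theorems of rows NE3∕NE7 and [B7] AS TYPED; nothing of Bałaban's asserted as an axiom; the consumer
((S-g′)'s re-issue of the decomposition with `sup‖X_N‖`) is the road's; NE3∕NE7 NOT proved; row NE7b (`T4WeightBudget.RelWeightBound`) NOT PRINTED ∕ NOT PROVED; spine count =
dagwriter's call; finite T⁴ rung (B)+1 — NOT infinite volume, NOT mass gap, NOT BetaPertH, NOT Clay (continuum YM on T⁴ ⇐ BetaPertH ∧ nine spine estimates).
-/

set_option autoImplicit false

open scoped BigOperators Matrix.Norms.L2Operator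
open NormedSpace Finset

namespace Summit.QuantumFields.BalabanUV.T4Continuum.NE7QbarIterPointwiseB8

open Literature.MathematicalPhysics.QuantumFieldTheory.Balaban1983to89
open B7Prop1Explicit B7Prop2Explicit B7Prop3Flat MatrixLog
open B7Prop1Local (InBox loK bondHiK)
open B7Prop3GeneralLinear (Ccov linQcov Qcov)
open B7Prop4GeneralLevels (logCovIter linCovIter)
open B7Prop5GeneralLevels (thetaGen)
open B7Prop5Flat (BondIn bondsIn boxFinset mem_bondsIn mem_boxFinset)
open B7Ineq146General (ineq146_general_uniform)
open B7Eq123General (prop4_general level_data blockLoops_of_pdev dbavgCovIter_eq_expCfg_logCovIter)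
open B7Eq92Concrete (dbavgCovIter)
open B12Ineq417Flat (shiftCfg shiftCfg_apply)
open B7AvgPeriodicity (periodic_of_coord logCovIter_periodic linCovIter_periodic Qcov_periodic)
open T4AveragingDeficitWall (IsSkewDir IsUnitaryCfg SmallField Ad dirSq)
open T4AveragingDeficitWallBoundary (IsPeriodicCfg periodBox mem_periodBox sum_periodBox_shift)
open AveragingDeficitPeriodicCounting (IsPeriodicDir)
open AveragingDeficitChartCalculus (cavg)
open AveragingDeficitMultiLevelPrep (cavgIter LevelSmall radIter tower cavgIter_unitary_small isPeriodicCfg_cavgIter)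
open AveragingDeficitMultiLevelBridge (cavgIter_eq_avgIter)
open AveragingDeficitTransport (norm_Ad_of_unitary)
open NE3TangentCovariantTower (QbarIter)
open NE3CovariantLineSumsL2 (l2sq l2sq_nonneg sqrt_l2sq_add_le)
open NE3FramePotBoundW (tower_eq_pow_mul levelSmall_of_le)
open NE3.QbarDictionary (adField)
open NE3.QbarTowerB8 (linCovIter_adField logCovIter_eq_zero_of_dbar)
open NE3.RemainderTowerPrepB8 (shiftCfg_of_isPeriodicCfg shiftCfg_of_isPeriodicDir l2sq_adField sqrt_l2sq_neg sqrt_l2sq_finset_sum_le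
  levelSmall_radIter sqrt_l2sq_linCovIter_le)
open NE3.RemainderSumsStepB8 (sum_normSq_Ccov_le sum_norm_Ccov_le)
open NE3.RemainderTelescopeB8 (linCovIter_sub_logCovIter_eq_sum linCovIter_one)
open NE3.RemainderTowerArith (tower_l2_induction geom_sum_L_le)
open ShellMeasureAverageProp4General (C1cov C1cov_pos)
open NE7QbarIterPointwiseB8Prep (sum_boxFinset_twoBlock_le sum_bondsIn_le_sum_boxFinset level_weight_eq logCovIter_add_period_tower
  isPeriodicDir_Ccov_tower sqrt_l2sq_logCovIter_le_tower pow_mul_period)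

noncomputable section

variable {d : ℕ} {n : Type*} [Fintype n] [DecidableEq n]

/-! ## The pointwise remainder tower -/

set_option maxHeartbeats 800000 in
/-- **THE POINTWISE SIZE OF THE NORMAL DATUM WITHOUT ANY SUP FACTOR OR REGULARITY OF `Z`**: under the hypotheses of `RemainderTowerB8.sqrt_l2sq_QbarIter_le` VERBATIM
(`2 ≤ L`, `1 ≤ N`, unitary `(N·L^{j+1})`-periodic `W` of the tower class, [B7]-Prop-4 regime `pdev W < α₀(L^{j+1})⁻²`, `C0·(2α₀) ≤ 1∕3`, `8α₀ ≤ c2′`, the smallness lines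
in `L^{j+1}b`, `(N·L^{j+1})`-periodic `Z` with `sup‖Z‖ ≤ b`, (1.37) `dbavgCovIter L W (expCfg (Ad_W Z)) (j+1) = 1`, `16·K·L^{j+1}·b ≤ ρ`) PLUS the k-free line
`8d·thetaGen d L (2α₀)·L⁻⁴ ≤ 1` ([B7] (145) at the level backgrounds' plaquette constant `2α₀`):
`‖QbarIter L (j+1) W Z z κ‖ ≤ 64·(1 + thetaGen d L (2α₀))·(C₁L²·d(4L+1)^d)·((Lʲ)²·((Lʲ)^d)⁻¹)·l2sq (periodBox (N·L^{j+1})) Z` at EVERY `z κ` —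
at `d = 4`: `≤ K·L²·M⁻²·‖Z‖²_{ℓ²}`, `M = L^{j+1}`, i.e. `≤ K·L²·‖Z‖_w²` in the energy currency (no sup factor: one power of `M⁻¹` better than `√dirSq φ̃ ≤ q₂‖Z‖_w`, `q₂ ∝ M·b`). [folklore] -/
theorem norm_QbarIter_le_pointwise [Nonempty n] {L N : ℕ} (hL : 2 ≤ L) (hN : 1 ≤ N) (j : ℕ)
    {W : Site d → Fin d → (Matrix n n ℂ)ˣ} {x : ℝ} (hWu : IsUnitaryCfg W) (hWP : IsPeriodicCfg W ((N * L ^ (j + 1) : ℕ) : ℤ))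
    (hx : 0 ≤ x) (hsm : LevelSmall d L j x) (hWx : SmallField W x)
    {α₀ b : ℝ} (hα : 0 < α₀) (hα3 : C0 d * (2 * α₀) ≤ 1 / 3) (hα4 : 4 * (2 * α₀) ≤ c2' d L)
    (h52 : pdev W < α₀ * (((L : ℝ) ^ (j + 1))⁻¹) ^ 2) (hb : 0 ≤ b)
    {Z : Site d → Fin d → Matrix n n ℂ} (hZ : ∀ (y : Site d) (κ : Fin d), ‖Z y κ‖ ≤ b) (hZP : IsPeriodicDir Z ((N * L ^ (j + 1) : ℕ) : ℤ))
    (hsmall : Real.exp (4 * (800 * ((d : ℝ) + 1) ^ 2 * ((d : ℝ) + 4)) * α₀)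
      * (1 + 8 * (131072 * ((d : ℝ) + 1) ^ 2) * ((L : ℝ) ^ (j + 1) * b)) ≤ 2)
    (hc₃ : 4 * ((L : ℝ) ^ (j + 1) * b) ≤ c3 d L)
    (hK : 16 * (C1cov d * (L : ℝ) ^ 2 * Real.sqrt (d * (2 * (2 * L) + 1) ^ d)) * (L : ℝ) ^ (j + 1) * b ≤ Real.sqrt ((L : ℝ) ^ 2 / (L : ℝ) ^ d))
    (h145' : 8 * d * thetaGen d L (2 * α₀) * (L : ℝ)⁻¹ ^ 4 ≤ 1)
    (hdbar : dbavgCovIter L W (expCfg (adField W Z)) (j + 1) = 1) (z : Site d) (κ : Fin d) :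
    ‖QbarIter L (j + 1) W Z z κ‖
      ≤ 64 * (1 + thetaGen d L (2 * α₀)) * (C1cov d * (L : ℝ) ^ 2 * (d * (2 * (2 * L) + 1) ^ d))
          * (((L : ℝ) ^ j) ^ 2 * ((((L : ℝ) ^ j) ^ d))⁻¹) * l2sq (periodBox (d := d) (N * L ^ (j + 1))) Z := by
  letI : CStarAlgebra (Matrix n n ℂ) := {}
  have hL1 : 1 ≤ L := by omega
  have hL0 : (0 : ℝ) < L := by exact_mod_cast (show 0 < L by omega)
  have hLR : (2 : ℝ) ≤ L := by exact_mod_cast hL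
  set k : ℕ := j + 1 with hk
  set ρ : ℝ := Real.sqrt ((L : ℝ) ^ 2 / (L : ℝ) ^ d) with hρdef
  have hρ0 : 0 < ρ := by rw [hρdef]; positivity
  have hρsq : ρ ^ 2 = (L : ℝ) ^ 2 / (L : ℝ) ^ d := by rw [hρdef, Real.sq_sqrt (by positivity)]
  have hC10 : 0 ≤ C1cov d * (L : ℝ) ^ 2 := by have := C1cov_pos d; positivity
  -- the fine field `B = Ad_W Z` and the regime data
  set B : Site d → Fin d → Matrix n n ℂ := adField W Z with hBdef
  have hBsup : ∀ (y : Site d) (κ : Fin d), ‖B y κ‖ ≤ b := fun y κ => by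
    rw [hBdef]; unfold adField; rw [norm_Ad_of_unitary (hWu y κ)]; exact hZ y κ
  have hG := avgClosed_unitaryUnits d (𝔸 := Matrix n n ℂ) L
  have hU₀ : ∀ (y : Site d) (κ : Fin d), W y κ ∈ unitaryUnits (Matrix n n ℂ) := hWu
  have hα3' : C0 d * α₀ ≤ 1 / 3 := by
    have hC : 0 ≤ C0 d := by unfold C0; positivity
    nlinarith
  have hα4' : 4 * α₀ ≤ c2' d L := by linarith
  have hc₃' : 2 * ((L : ℝ) ^ k * b) ≤ c3 d L := by rw [hk]; nlinarith [pow_pos hL0 (j + 1)]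
  have h4 := prop4_general L hL hG k W hU₀ hα hα3' hα4' h52 B hb hBsup hsmall hc₃'
  have hld := level_data L hL hG k W hU₀ hα hα3' hα4' h52
  -- loops of every averaged background below the top
  have hloopsW : ∀ i < k, ∀ (z : Site d) (κ : Fin d) (r : Fin d → Fin L),
      ‖((Wcx L (cavgIter L i W) ((L : ℤ) • z) κ (boxVec L r) : (Matrix n n ℂ)ˣ) : Matrix n n ℂ) - 1‖ < 1 := by
    intro i hi z κ r
    obtain ⟨hV, hβ0, hβ, hβmax⟩ := hld i hi.le
    rw [cavgIter_eq_avgIter]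
    have h := blockLoops_of_pdev hL1 hV hβ0 hβ hβmax ((L : ℤ) • z) κ
    exact ((h.1 r).trans h.2).trans_lt (by norm_num)
  -- the nonlinear iterates: sup (Prop. 4), periodicity; the one-step remainder fields and their periodicity; the ℓ² sizes (file 1∕2)
  have hAsup : ∀ i ≤ k, ∀ (y : Site d) (κ : Fin d), ‖logCovIter L W B i y κ‖ ≤ 2 * ((L : ℝ) ^ i * b) :=
    fun i hi => (h4 i hi).2
  have hAP : ∀ i ≤ k, ∀ (y : Site d) (κ μ : Fin d),
      logCovIter L W B i (y + ((N * L ^ (k - i) : ℕ) : ℤ) • e κ) μ = logCovIter L W B i y μ :=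
    logCovIter_add_period_tower j hWP hZP
  set Cf : ℕ → Site d → Fin d → Matrix n n ℂ :=
    fun i z κ => Ccov L (avgIter L W i) (logCovIter L W B i) ((L : ℤ) • z) κ with hCf
  set a : ℕ → ℝ := fun i => Real.sqrt (l2sq (periodBox (d := d) (N * L ^ (k - i))) (logCovIter L W B i)) with hadef
  set β : ℝ := Real.sqrt (l2sq (periodBox (d := d) (N * L ^ k)) Z) with hβdef
  have hβ0 : 0 ≤ β := Real.sqrt_nonneg _
  have hβsq : β ^ 2 = l2sq (periodBox (d := d) (N * L ^ k)) Z := by rw [hβdef, Real.sq_sqrt (l2sq_nonneg _ _)]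
  have hCfP : ∀ i < k, IsPeriodicDir (Cf i) ((N * L ^ (k - (i + 1)) : ℕ) : ℤ) := isPeriodicDir_Ccov_tower j hWP hZP
  have hA4 : ∀ i ≤ k, a i ≤ 4 * ρ ^ i * β := fun i hi => by
    have h := sqrt_l2sq_logCovIter_le_tower hL hN j hWu hWP hZP hx hsm hWx hα hα3 hα4 h52 hb hZ hsmall hc₃ hK i hi
    simpa only [hadef, hρdef, hβdef, hBdef, hk, mul_assoc] using h
  -- the full remainder at the top, with `A_k = 0` by (1.37): POINTWISE
  have hQ := dbavgCovIter_eq_expCfg_logCovIter L hL hG k W hU₀ hα hα3' hα4' h52 B hb hBsup hsmall hc₃'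
  have hzero : logCovIter L W B k = fun _ _ => 0 := by
    rw [hk]; exact logCovIter_eq_zero_of_dbar L W B j (hQ j (by omega)) hdbar
  have hidk := linCovIter_sub_logCovIter_eq_sum L hL hG k W hU₀ hα hα3 hα4 h52 B
  have hlin : linCovIter L W B k = -∑ i ∈ Finset.range k, linCovIter L (avgIter L W (i + 1)) (Cf i) (k - (i + 1)) := by
    have h := hidk
    rw [hzero] at h
    have e : linCovIter L W B k - (fun _ _ => (0 : Matrix n n ℂ)) = linCovIter L W B k := by
      funext z κ; simp
    rw [e] at h
    exact h
  have hpt : ‖linCovIter L W B k z κ‖ ≤ ∑ i ∈ Finset.range k, ‖linCovIter L (avgIter L W (i + 1)) (Cf i) (k - (i + 1)) z κ‖ := by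
    rw [hlin, Pi.neg_apply, Pi.neg_apply, norm_neg, Finset.sum_apply, Finset.sum_apply]
    exact norm_sum_le _ _
  -- each propagated remainder AT THE BOND: (146) general × two-block mass × period mass × one-step ℓ¹ letter
  have hterm : ∀ i ∈ Finset.range k, ‖linCovIter L (avgIter L W (i + 1)) (Cf i) (k - (i + 1)) z κ‖
      ≤ (1 + thetaGen d L (2 * α₀)) * ((L : ℝ) ^ (k - (i + 1)) * ((((L : ℝ) ^ (k - (i + 1))) ^ d))⁻¹)
          * (2 * ((C1cov d * (L : ℝ) ^ 2 * (d * (2 * (2 * L) + 1) ^ d)) * (a i) ^ 2)) := by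
    intro i hi
    have hik : i < k := Finset.mem_range.mp hi
    set m : ℕ := k - (i + 1) with hm
    -- regime of the base `Ū₀^{i+1}`
    obtain ⟨hV, hβ0', hβ', hβmax'⟩ := hld (i + 1) (by omega)
    obtain ⟨hW'u, -, -⟩ := cavgIter_unitary_small hL1 i hWu hx (levelSmall_of_le (by omega) hsm) hWx
    have hU₁ : ∀ (y : Site d) (κ : Fin d), avgIter L W (i + 1) y κ ∈ unitaryUnits (Matrix n n ℂ) := by
      intro y κ'; rw [← cavgIter_eq_avgIter]; exact hW'u y κ'
    have h52' : pdev (avgIter L W (i + 1)) < (2 * α₀) * (((L : ℝ) ^ m)⁻¹) ^ 2 := by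
      refine hβ'.trans_le (le_of_eq ?_)
      have hkm : k = (i + 1) + m := by omega
      have e : (L : ℝ) ^ (i + 1) * ((L : ℝ) ^ k)⁻¹ = ((L : ℝ) ^ m)⁻¹ := by
        rw [hkm, pow_add (L : ℝ) (i + 1) m, mul_inv, ← mul_assoc, mul_inv_cancel₀ (pow_ne_zero _ hL0.ne'), one_mul]
      rw [e]; ring
    have hα2 : 0 < 2 * α₀ := by positivity
    -- (146) for the general field `Cf i` at the base `Ū₀^{i+1}`, level `m ≤ m`
    have h146 := ineq146_general_uniform L hL hG m (avgIter L W (i + 1)) hU₁ hα2 hα3 hα4 h52' h145' (Cf i) (le_refl m) z κ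
    -- the two-block ℓ¹-mass against the period mass
    have hN₁ : 1 ≤ N * L ^ (k - (i + 1)) := Nat.one_le_iff_ne_zero.mpr (Nat.mul_ne_zero (by omega) (pow_ne_zero _ (by omega)))
    set gC : Site d → ℝ := fun y => ∑ μ : Fin d, ‖Cf i y μ‖ with hgC
    have hgC0 : ∀ y, 0 ≤ gC y := fun y => Finset.sum_nonneg fun μ _ => norm_nonneg _
    have hgCP : ∀ (y : Site d) (κ' : Fin d), gC (y + ((N * L ^ (k - (i + 1)) : ℕ) : ℤ) • e κ') = gC y := by
      intro y κ'; simp only [hgC, hCfP i hik y κ']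
    have hLmP : L ^ m ≤ N * L ^ (k - (i + 1)) := by rw [hm]; exact Nat.le_mul_of_pos_left _ (by omega)
    have hmass1 : ∑ bnd ∈ bondsIn (loK L m z) (bondHiK L m z κ), ‖Cf i bnd.1 bnd.2‖
        ≤ ∑ y ∈ boxFinset (loK L m z) (bondHiK L m z κ), gC y :=
      sum_bondsIn_le_sum_boxFinset _ _ (fun y μ => ‖Cf i y μ‖) fun y μ => norm_nonneg _
    have hmass2 : ∑ y ∈ boxFinset (loK L m z) (bondHiK L m z κ), gC y ≤ 2 * ∑ y ∈ periodBox (d := d) (N * L ^ (k - (i + 1))), gC y :=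
      sum_boxFinset_twoBlock_le hLmP hN₁ z κ hgC0 hgCP
    -- the period ℓ¹-mass of `C_i` against `‖A_i‖²_{ℓ²}` (NO sup factor)
    have hLN : L * (N * L ^ (k - (i + 1))) = N * L ^ (k - i) := by
      rw [mul_left_comm, ← pow_succ']; congr 2; omega
    have hLi : (L : ℝ) ^ i ≤ (L : ℝ) ^ k := pow_le_pow_right₀ (by linarith) hik.le
    have ha0 : 0 ≤ 2 * ((L : ℝ) ^ i * b) := by positivity
    have hac : 2 * ((L : ℝ) ^ i * b) ≤ c3 d L / 2 := by
      have h1 : (L : ℝ) ^ i * b ≤ (L : ℝ) ^ k * b := mul_le_mul_of_nonneg_right hLi hb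
      linarith
    obtain ⟨hVi, hβ0i, hβi, hβmaxi⟩ := hld i hik.le
    have hAP' : ∀ (y : Site d) (κ μ : Fin d),
        logCovIter L W B i (y + ((L * (N * L ^ (k - (i + 1))) : ℕ) : ℤ) • e κ) μ = logCovIter L W B i y μ := by
      rw [hLN]; exact hAP i hik.le
    have hstep := sum_norm_Ccov_le hL1 hVi hβ0i hβi hβmaxi hN₁ (logCovIter L W B i) ha0 (hAsup i hik.le) hac hAP'
    rw [hLN] at hstep
    have hmass3 : ∑ y ∈ periodBox (d := d) (N * L ^ (k - (i + 1))), gC y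
        ≤ (C1cov d * (L : ℝ) ^ 2 * (d * (2 * (2 * L) + 1) ^ d)) * (a i) ^ 2 := by
      have e : (a i) ^ 2 = ∑ y ∈ periodBox (d := d) (N * L ^ (k - i)), ∑ μ : Fin d, ‖logCovIter L W B i y μ‖ ^ 2 := by
        rw [hadef, Real.sq_sqrt (l2sq_nonneg _ _)]; simp only [l2sq]
      rw [e]
      exact hstep
    have hw0 : 0 ≤ (1 + thetaGen d L (2 * α₀)) * ((L : ℝ) ^ m * ((((L : ℝ) ^ m) ^ d))⁻¹) := by
      have : 0 ≤ thetaGen d L (2 * α₀) := by unfold thetaGen; positivity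
      positivity
    calc ‖linCovIter L (avgIter L W (i + 1)) (Cf i) m z κ‖
        ≤ (1 + thetaGen d L (2 * α₀)) * ((L : ℝ) ^ m * ((((L : ℝ) ^ m) ^ d))⁻¹)
            * ∑ bnd ∈ bondsIn (loK L m z) (bondHiK L m z κ), ‖Cf i bnd.1 bnd.2‖ := h146
      _ ≤ (1 + thetaGen d L (2 * α₀)) * ((L : ℝ) ^ m * ((((L : ℝ) ^ m) ^ d))⁻¹)
            * (2 * ((C1cov d * (L : ℝ) ^ 2 * (d * (2 * (2 * L) + 1) ^ d)) * (a i) ^ 2)) := by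
          refine mul_le_mul_of_nonneg_left ?_ hw0
          exact hmass1.trans (hmass2.trans (by linarith [hmass3]))
  -- collect: `(a i)² ≤ 16ρ^{2i}β²` and the exponent bookkeeping
  have hsum : ∑ i ∈ Finset.range k, ‖linCovIter L (avgIter L W (i + 1)) (Cf i) (k - (i + 1)) z κ‖
      ≤ 64 * (1 + thetaGen d L (2 * α₀)) * (C1cov d * (L : ℝ) ^ 2 * (d * (2 * (2 * L) + 1) ^ d))
          * (((L : ℝ) ^ j) ^ 2 * ((((L : ℝ) ^ j) ^ d))⁻¹) * β ^ 2 := by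
    have hθ0 : 0 ≤ thetaGen d L (2 * α₀) := by unfold thetaGen; positivity
    set C₁' : ℝ := C1cov d * (L : ℝ) ^ 2 * (d * (2 * (2 * L) + 1) ^ d) with hC₁'
    have hC₁'0 : 0 ≤ C₁' := by rw [hC₁']; positivity
    have hterm' : ∀ i ∈ Finset.range k, ‖linCovIter L (avgIter L W (i + 1)) (Cf i) (k - (i + 1)) z κ‖
        ≤ 32 * (1 + thetaGen d L (2 * α₀)) * C₁' * β ^ 2 * ((L : ℝ) ^ (k - 1 + i) * ((((L : ℝ) ^ (k - 1)) ^ d))⁻¹) := by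
      intro i hi
      have hik : i < k := Finset.mem_range.mp hi
      have h1 := hterm i hi
      have ha2 : (a i) ^ 2 ≤ 16 * (ρ ^ 2) ^ i * β ^ 2 := by
        have ha0' : 0 ≤ a i := by rw [hadef]; exact Real.sqrt_nonneg _
        have h := hA4 i hik.le
        calc (a i) ^ 2 ≤ (4 * ρ ^ i * β) ^ 2 := pow_le_pow_left₀ ha0' h 2
          _ = 16 * (ρ ^ 2) ^ i * β ^ 2 := by rw [← pow_mul, mul_comm 2 i, pow_mul]; ring
      have hkm : k - (i + 1) = k - 1 - i := by omega
      have hwt : (L : ℝ) ^ (k - 1 - i) * ((((L : ℝ) ^ (k - 1 - i)) ^ d))⁻¹ * ((L : ℝ) ^ 2 / (L : ℝ) ^ d) ^ i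
          = (L : ℝ) ^ (k - 1 + i) * ((((L : ℝ) ^ (k - 1)) ^ d))⁻¹ :=
        level_weight_eq hL0 d (k - 1 - i) i (by omega) (by omega)
      have hw0 : 0 ≤ (1 + thetaGen d L (2 * α₀)) * ((L : ℝ) ^ (k - 1 - i) * ((((L : ℝ) ^ (k - 1 - i)) ^ d))⁻¹) := by positivity
      rw [hkm] at h1 ⊢
      calc ‖linCovIter L (avgIter L W (i + 1)) (Cf i) (k - 1 - i) z κ‖
          ≤ (1 + thetaGen d L (2 * α₀)) * ((L : ℝ) ^ (k - 1 - i) * ((((L : ℝ) ^ (k - 1 - i)) ^ d))⁻¹) * (2 * (C₁' * (a i) ^ 2)) := h1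
        _ ≤ (1 + thetaGen d L (2 * α₀)) * ((L : ℝ) ^ (k - 1 - i) * ((((L : ℝ) ^ (k - 1 - i)) ^ d))⁻¹) * (2 * (C₁' * (16 * (ρ ^ 2) ^ i * β ^ 2))) := by
            refine mul_le_mul_of_nonneg_left ?_ hw0
            nlinarith [mul_le_mul_of_nonneg_left ha2 hC₁'0]
        _ = 32 * (1 + thetaGen d L (2 * α₀)) * C₁' * β ^ 2
              * ((L : ℝ) ^ (k - 1 - i) * ((((L : ℝ) ^ (k - 1 - i)) ^ d))⁻¹ * ((L : ℝ) ^ 2 / (L : ℝ) ^ d) ^ i) := by rw [hρsq]; ring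
        _ = 32 * (1 + thetaGen d L (2 * α₀)) * C₁' * β ^ 2 * ((L : ℝ) ^ (k - 1 + i) * ((((L : ℝ) ^ (k - 1)) ^ d))⁻¹) := by rw [hwt]
    have hgeo : ∑ i ∈ Finset.range k, (L : ℝ) ^ (k - 1 + i) * ((((L : ℝ) ^ (k - 1)) ^ d))⁻¹
        ≤ 2 * (((L : ℝ) ^ j) ^ 2 * ((((L : ℝ) ^ j) ^ d))⁻¹) := by
      have hkj : k - 1 = j := by omega
      rw [← Finset.sum_mul, hkj]
      have hs : ∑ i ∈ Finset.range k, (L : ℝ) ^ (j + i) = (L : ℝ) ^ j * ∑ i ∈ Finset.range k, (L : ℝ) ^ i := by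
        rw [Finset.mul_sum]; exact Finset.sum_congr rfl fun i _ => pow_add _ _ _
      rw [hs]
      have hg := geom_sum_L_le hLR k
      rw [hkj] at hg
      have hLj : 0 ≤ (L : ℝ) ^ j := by positivity
      have hinv : 0 ≤ ((((L : ℝ) ^ j) ^ d))⁻¹ := by positivity
      calc (L : ℝ) ^ j * (∑ i ∈ Finset.range k, (L : ℝ) ^ i) * ((((L : ℝ) ^ j) ^ d))⁻¹
          ≤ (L : ℝ) ^ j * (2 * (L : ℝ) ^ j) * ((((L : ℝ) ^ j) ^ d))⁻¹ :=
            mul_le_mul_of_nonneg_right (mul_le_mul_of_nonneg_left hg hLj) hinv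
        _ = 2 * (((L : ℝ) ^ j) ^ 2 * ((((L : ℝ) ^ j) ^ d))⁻¹) := by ring
    have hpre : 0 ≤ 32 * (1 + thetaGen d L (2 * α₀)) * C₁' * β ^ 2 := by positivity
    calc ∑ i ∈ Finset.range k, ‖linCovIter L (avgIter L W (i + 1)) (Cf i) (k - (i + 1)) z κ‖
        ≤ ∑ i ∈ Finset.range k, 32 * (1 + thetaGen d L (2 * α₀)) * C₁' * β ^ 2 * ((L : ℝ) ^ (k - 1 + i) * ((((L : ℝ) ^ (k - 1)) ^ d))⁻¹) :=
          Finset.sum_le_sum hterm'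
      _ = 32 * (1 + thetaGen d L (2 * α₀)) * C₁' * β ^ 2 * ∑ i ∈ Finset.range k, (L : ℝ) ^ (k - 1 + i) * ((((L : ℝ) ^ (k - 1)) ^ d))⁻¹ := by
          rw [Finset.mul_sum]
      _ ≤ 32 * (1 + thetaGen d L (2 * α₀)) * C₁' * β ^ 2 * (2 * (((L : ℝ) ^ j) ^ 2 * ((((L : ℝ) ^ j) ^ d))⁻¹)) :=
          mul_le_mul_of_nonneg_left hgeo hpre
      _ = 64 * (1 + thetaGen d L (2 * α₀)) * C₁' * (((L : ℝ) ^ j) ^ 2 * ((((L : ℝ) ^ j) ^ d))⁻¹) * β ^ 2 := by ring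
  -- back to `QbarIter`: `L^kηQ_kB = Ad (QbarIter)` bondwise and `Ad` is isometric
  have hVk : IsUnitaryCfg (cavgIter L k W) := by
    rw [hk]; exact (cavgIter_unitary_small hL1 j hWu hx hsm hWx).1
  have hdict : linCovIter L W B k = adField (cavgIter L k W) (QbarIter L k W Z) := linCovIter_adField L W Z k hloopsW
  have hnorm : ‖QbarIter L k W Z z κ‖ = ‖linCovIter L W B k z κ‖ := by
    rw [hdict]; unfold adField; rw [norm_Ad_of_unitary (hVk z κ)]
  rw [hnorm, ← hβsq]
  exact hpt.trans hsum

end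

end Summit.QuantumFields.BalabanUV.T4Continuum.NE7QbarIterPointwiseB8
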